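/-
Copyright (c) 2026 the pub-hodgecm-mathlib formalisation cell (harness21).  Prover seat hodgecm-mathlib-K2Liu-p13 (g2), Track B «K2-LIT»,
#184♮ = hLiu418 = `stmt-HodgeConjecture-24832`; Road I v3 organ U1-CT-ind STAGE 2 (Q2), file F5-i (toward the `νN = Φ_*(μ_Z × μ)` binder of ★ F5-e).
-/
import Summits.HodgeConjecture.HodgeConjecture.Theorems.K2LiuKlingenUnipotentAdelicDefs     -- ★ F4-1: `jAdelic`, `klingenUnipA`, `mem_klingenUnipA_iff` (+ ★ F4-0)
import Literature.NumberTheory.Automorphic.UnitaryGroupOfFormAdelicTopology              -- ★ `continuous_conjAdele`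
import Mathlib.Topology.Instances.Matrix
import HarnessLib

/-!
# Crux `HLiu418`, Road I v3, organ U1 stage 2 (Q2), file F5-i: THE HEISENBERG CHART OF `N_Q(𝔸)` — `(z; y, t) ↦ Ψ(n_Q(y,z,t))` is a homeomorphism
# `𝔸_L × (𝔸_L^{skew} × 𝔸_L) ≃ₜ N_Q(𝔸)` with the Heisenberg multiplication law in coordinates

Cell `hodgecm-mathlib`, crux item hLiu418 = `stmt-HodgeConjecture-24832`; squad K2 ∕ K2Liu; LEAD F0P6-plan (g14), co-dealer K2E5-plan (g7); prover K2Liu-p13 (g2).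
THEOREMS ONLY (no `def`, no instance, no notation, no named-fact hypothesis, no `sorry`); lane `--supports stmt-HodgeConjecture-24832 --as helper` (count-neutral).
The skew part `𝔸_L^{skew}` is ANY additive subgroup `Y ≤ 𝔸_L` with the membership law `hY : y ∈ Y ↔ σ y = −y` (cells BY NAME).  The chart is the bare lambda
`Φ(z, (y, t)) = ⟨Ψ(jAdelic n_Q(y, z, t)), _⟩ : ↥(klingenUnipA Ψ)` (order `(z; y, t)` = ★ F5-e's `Z × P`, `u₊(z) · n_Q(y,0,t) = n_Q(y,z,t)` ★ F5-c `nKlingen_eq_uPlus_mul`).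
* §1 (topological comm ring `R`, `σ` continuous) `continuous_nKlingenM`, **`continuous_nKlingen_val`** (into `GL₄(R)`: both `n_Q` and `n_Q⁻¹ = n_Q(·)` have polynomial entries,
  `Units.continuous_iff`), `continuous_nKlingen` (into `U(J₄)(R)`).
* §2 (adelic, `n = 2`; continuity INTO `H(𝔸)` through the transport clause (T1) `↑(Ψ g) = SA·g·SA⁻¹` at matrix level — `H(𝔸)` is a plain subtype of `GL_{2+2}(𝔸_L)`)
  **`continuous_transport_nKlingen`**, **`continuous_klingenChart`**, `klingenChart_injective`, `klingenChart_surjective`, **`klingenChart_mul`** (Heisenberg law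
  `Φ(z;y,t)·Φ(z′;y′,t′) = Φ(z+z′; y+y′+(z′σt − tσz′), t+t′)`), the inverse coordinates **`continuous_klingenCoords`** (entries `(0,2)`, `(0,3)+(0,2)σ(0,1)`, `(0,1)` of `Ψ⁻¹u`,
  continuous on all of `H(𝔸)`) and `klingenCoords_transport_nKlingen` (they recover `(z; y, t)`) — so `Φ` is a continuous bijection with continuous inverse, i.e. the
  consumer's `Homeomorph.mk` ∕ `MeasurableEquiv` (no `def` here).
[MoeglinWaldspurger1995, I.2.1], [Xiong2013, §7 Lemma 7.1], [Weil1965, §37], [GanTakeda2011SiegelWeil, §7.2 p. 23].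
HONEST LABEL.  Count-neutral helper: `HC_CM` is proved only modulo the 7 printed citations (2 remaining named inputs: hLiu418 = `stmt-HodgeConjecture-24832`,
h413 = `stmt-HodgeConjecture-24833`) until rung 0 closes.
-/

set_option autoImplicit false
set_option linter.dupNamespace false -- the mandated namespace repeats `HodgeConjecture.HodgeConjecture`

noncomputable section

open scoped Matrix
open NumberField IsDedekindDomain Topology

namespace Summit.HodgeConjecture.HodgeConjecture.Cruxes.HLiu418.K2LiuKlingenUnipotentAdelicChart

open Literature.NumberTheory.Automorphic Literature.NumberTheory.Automorphic.UnitaryGroup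
open Literature.NumberTheory.GelbartRogawski1991 Literature.NumberTheory.GelbartRogawski1991.GRConstruction
open Literature.NumberTheory.K2Lit.SiegelDoubled
open Summit.HodgeConjecture.HodgeConjecture.Cruxes.HLiu418.K2LiuDoubledUTwoTwoBorelFrame
open Summit.HodgeConjecture.HodgeConjecture.Cruxes.HLiu418.K2LiuKlingenParabolicDefs
open Summit.HodgeConjecture.HodgeConjecture.Cruxes.HLiu418.K2LiuKlingenUnipotentDefs
open Summit.HodgeConjecture.HodgeConjecture.Cruxes.HLiu418.K2LiuKlingenUnipotentAdelicDefs
open Summit.HodgeConjecture.HodgeConjecture.Cruxes.HLiu418.K2LiuSiegelDoubledLeviMatrix (conjAdele_conjAdele')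
open UnitaryDualPair

/-! ## §1 Continuity of the letter `n_Q(y,z,t)` over a topological ring -/

section Generic

variable {R : Type*} [CommRing R] [TopologicalSpace R] [IsTopologicalRing R] {σ : R →+* R}

/-- the matrix `nKlingenM y z t` depends continuously on `(z; y, t)` (`σ` continuous). [cite: Weil1965, §37] -/
theorem continuous_nKlingenM (hσc : Continuous σ) {X : Type*} [TopologicalSpace X] {y z t : X → R} (hy : Continuous y) (hz : Continuous z)
    (ht : Continuous t) : Continuous fun x => nKlingenM R σ (y x) (z x) (t x) := by
  refine continuous_matrix fun i j => ?_
  fin_cases i <;> fin_cases j <;> simp [nKlingenM] <;> fun_prop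

/-- **the invertible matrix of `n_Q(y,z,t)` depends continuously on `(z; y, t)`**: both `n_Q` and `n_Q⁻¹ = n_Q(−y + (zσt − tσz), −z, −t)` have polynomial entries
(`Units.continuous_iff`). [cite: Weil1965, §37] [cite: Xiong2013, §7 Lemma 7.1] -/
theorem continuous_nKlingen_val (hσ : ∀ x, σ (σ x) = x) (hσc : Continuous σ) {X : Type*} [TopologicalSpace X] {y z t : X → R}
    (hys : ∀ x, σ (y x) = -(y x)) (hy : Continuous y) (hz : Continuous z) (ht : Continuous t) :
    Continuous fun x => ((nKlingen R σ hσ (y x) (hys x) (z x) (t x) : unitaryGroupOfForm σ _) : GL (Fin 4) R) := by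
  refine Units.continuous_iff.2 ⟨?_, ?_⟩
  · exact (continuous_nKlingenM hσc hy hz ht).congr fun x => (coe_nKlingen hσ (y x) (hys x) (z x) (t x)).symm
  · have h : ∀ x, (((((nKlingen R σ hσ (y x) (hys x) (z x) (t x) : unitaryGroupOfForm σ _) : GL (Fin 4) R))⁻¹ : GL (Fin 4) R) : Matrix (Fin 4) (Fin 4) R) =
        nKlingenM R σ (-(y x) + (z x * σ (t x) - t x * σ (z x))) (-(z x)) (-(t x)) := fun x => by
      rw [← Subgroup.coe_inv, nKlingen_inv hσ, coe_nKlingen]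
    exact (continuous_nKlingenM hσc (y := fun x => -(y x) + (z x * σ (t x) - t x * σ (z x))) (z := fun x => -(z x)) (t := fun x => -(t x))
      (by fun_prop) (by fun_prop) (by fun_prop)).congr fun x => (h x).symm

/-- `n_Q(y,z,t) ∈ U(J₄)(R)` depends continuously on `(z; y, t)`. [cite: Weil1965, §37] -/
theorem continuous_nKlingen (hσ : ∀ x, σ (σ x) = x) (hσc : Continuous σ) {X : Type*} [TopologicalSpace X] {y z t : X → R}
    (hys : ∀ x, σ (y x) = -(y x)) (hy : Continuous y) (hz : Continuous z) (ht : Continuous t) :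
    Continuous fun x => (nKlingen R σ hσ (y x) (hys x) (z x) (t x) : unitaryGroupOfForm σ ((StdForm.antidiagonal 4).over R)) :=
  continuous_induced_rng.2 (continuous_nKlingen_val hσ hσc hys hy hz ht)

end Generic

/-! ## §2 The adelic Heisenberg chart of `N_Q(𝔸)` (`n = 2`) -/

variable {L : Type} [Field L] [NumberField L] [IsCMField L]
variable {N M : ℕ} {e : Fin N × Fin M ≃ Fin 2}
  {dV : Fin N → L} {hdV : ∀ i, IsCMField.complexConj L (dV i) = dV i}
  {dW : Fin M → L} {hdW : ∀ i, IsCMField.complexConj L (dW i) = dW i}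

/-- **`x ↦ Ψ(n_Q(y_x, z_x, t_x)) ∈ H(𝔸)` is continuous** for continuous coordinates, through the transport clause (T1) `↑(Ψ g) = SA · g · SA⁻¹` (matrix level:
both `Ψ(n_Q)` and its inverse `Ψ(n_Q⁻¹) = Ψ(n_Q(·))` have matrices `SA · nKlingenM(·) · SA⁻¹`, `Units.continuous_iff`). [cite: Weil1965, §37] [cite: MoeglinWaldspurger1995, I.2.1] -/
theorem continuous_transport_nKlingen {SA : GL (Fin (2 + 2)) (AdeleRing (𝓞 L) L)}
    {Ψ : (quasiSplit (Fp L) L (IsCMField.complexConj L) (2 + 2)).Adelic ≃ₜ* HA L e dV hdV dW hdW}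
    (hΨ : ∀ g : (quasiSplit (Fp L) L (IsCMField.complexConj L) (2 + 2)).Adelic,
      (((Ψ g : HA L e dV hdV dW hdW) : GL (Fin (2 + 2)) (AdeleRing (𝓞 L) L)) : Matrix (Fin (2 + 2)) (Fin (2 + 2)) (AdeleRing (𝓞 L) L)) =
        (SA : Matrix (Fin (2 + 2)) (Fin (2 + 2)) (AdeleRing (𝓞 L) L)) *
          ((adelicVal (Fp L) L (IsCMField.complexConj L) (2 + 2) _ g : GL (Fin (2 + 2)) (AdeleRing (𝓞 L) L)) :
            Matrix (Fin (2 + 2)) (Fin (2 + 2)) (AdeleRing (𝓞 L) L)) *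
          ((SA⁻¹ : GL (Fin (2 + 2)) (AdeleRing (𝓞 L) L)) : Matrix (Fin (2 + 2)) (Fin (2 + 2)) (AdeleRing (𝓞 L) L)))
    {X : Type*} [TopologicalSpace X] {y z t : X → AdeleRing (𝓞 L) L} (hys : ∀ x, conjAdele (Fp L) L (IsCMField.complexConj L) (y x) = -(y x))
    (hy : Continuous y) (hz : Continuous z) (ht : Continuous t) :
    Continuous fun x => (Ψ (jAdelic L 4 (nKlingen (AdeleRing (𝓞 L) L) (conjAdele (Fp L) L (IsCMField.complexConj L)) (conjAdele_conjAdele' L)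
      (y x) (hys x) (z x) (t x))) : HA L e dV hdV dW hdW) := by
  have hσc := continuous_conjAdele (Fp L) L (IsCMField.complexConj L)
  refine continuous_induced_rng.2 (Units.continuous_iff.2 ⟨?_, ?_⟩)
  · show Continuous fun x => (((Ψ (jAdelic L 4 (nKlingen (AdeleRing (𝓞 L) L) (conjAdele (Fp L) L (IsCMField.complexConj L)) (conjAdele_conjAdele' L)
      (y x) (hys x) (z x) (t x))) : HA L e dV hdV dW hdW) : GL (Fin (2 + 2)) (AdeleRing (𝓞 L) L)) : Matrix (Fin (2 + 2)) (Fin (2 + 2)) (AdeleRing (𝓞 L) L))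
    have h : ∀ x, (((Ψ (jAdelic L 4 (nKlingen (AdeleRing (𝓞 L) L) (conjAdele (Fp L) L (IsCMField.complexConj L)) (conjAdele_conjAdele' L)
        (y x) (hys x) (z x) (t x))) : HA L e dV hdV dW hdW) : GL (Fin (2 + 2)) (AdeleRing (𝓞 L) L)) : Matrix (Fin (2 + 2)) (Fin (2 + 2)) (AdeleRing (𝓞 L) L)) =
        (SA : Matrix (Fin (2 + 2)) (Fin (2 + 2)) (AdeleRing (𝓞 L) L)) *
          nKlingenM (AdeleRing (𝓞 L) L) (conjAdele (Fp L) L (IsCMField.complexConj L)) (y x) (z x) (t x) *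
          ((SA⁻¹ : GL (Fin (2 + 2)) (AdeleRing (𝓞 L) L)) : Matrix (Fin (2 + 2)) (Fin (2 + 2)) (AdeleRing (𝓞 L) L)) := fun x => by
      rw [hΨ, coe_adelicVal_jAdelic_nKlingen]
    exact ((continuous_const.mul (continuous_nKlingenM hσc hy hz ht)).mul continuous_const).congr fun x => (h x).symm
  · show Continuous fun x => ((((Ψ (jAdelic L 4 (nKlingen (AdeleRing (𝓞 L) L) (conjAdele (Fp L) L (IsCMField.complexConj L)) (conjAdele_conjAdele' L)
      (y x) (hys x) (z x) (t x))) : HA L e dV hdV dW hdW) : GL (Fin (2 + 2)) (AdeleRing (𝓞 L) L))⁻¹ : GL (Fin (2 + 2)) (AdeleRing (𝓞 L) L)) :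
        Matrix (Fin (2 + 2)) (Fin (2 + 2)) (AdeleRing (𝓞 L) L))
    have h : ∀ x, ((((Ψ (jAdelic L 4 (nKlingen (AdeleRing (𝓞 L) L) (conjAdele (Fp L) L (IsCMField.complexConj L)) (conjAdele_conjAdele' L)
        (y x) (hys x) (z x) (t x))) : HA L e dV hdV dW hdW) : GL (Fin (2 + 2)) (AdeleRing (𝓞 L) L))⁻¹ : GL (Fin (2 + 2)) (AdeleRing (𝓞 L) L)) :
          Matrix (Fin (2 + 2)) (Fin (2 + 2)) (AdeleRing (𝓞 L) L)) =
        (SA : Matrix (Fin (2 + 2)) (Fin (2 + 2)) (AdeleRing (𝓞 L) L)) *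
          nKlingenM (AdeleRing (𝓞 L) L) (conjAdele (Fp L) L (IsCMField.complexConj L))
            (-(y x) + (z x * conjAdele (Fp L) L (IsCMField.complexConj L) (t x) - t x * conjAdele (Fp L) L (IsCMField.complexConj L) (z x))) (-(z x)) (-(t x)) *
          ((SA⁻¹ : GL (Fin (2 + 2)) (AdeleRing (𝓞 L) L)) : Matrix (Fin (2 + 2)) (Fin (2 + 2)) (AdeleRing (𝓞 L) L)) := fun x => by
      rw [← Subgroup.coe_inv, ← map_inv, ← map_inv, nKlingen_inv (conjAdele_conjAdele' L), hΨ, coe_adelicVal_jAdelic_nKlingen]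
    exact ((continuous_const.mul (continuous_nKlingenM hσc ((hy.neg).add ((hz.mul (hσc.comp ht)).sub (ht.mul (hσc.comp hz)))) hz.neg ht.neg)).mul
      continuous_const).congr fun x => (h x).symm

/-- **the Heisenberg chart `Φ(z; y, t) = Ψ(n_Q(y,z,t))` is continuous** into `N_Q(𝔸)` (clause (T1)). [cite: Weil1965, §37] [cite: MoeglinWaldspurger1995, I.2.1] -/
theorem continuous_klingenChart {SA : GL (Fin (2 + 2)) (AdeleRing (𝓞 L) L)}
    (Ψ : (quasiSplit (Fp L) L (IsCMField.complexConj L) (2 + 2)).Adelic ≃ₜ* HA L e dV hdV dW hdW)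
    (hΨ : ∀ g : (quasiSplit (Fp L) L (IsCMField.complexConj L) (2 + 2)).Adelic,
      (((Ψ g : HA L e dV hdV dW hdW) : GL (Fin (2 + 2)) (AdeleRing (𝓞 L) L)) : Matrix (Fin (2 + 2)) (Fin (2 + 2)) (AdeleRing (𝓞 L) L)) =
        (SA : Matrix (Fin (2 + 2)) (Fin (2 + 2)) (AdeleRing (𝓞 L) L)) *
          ((adelicVal (Fp L) L (IsCMField.complexConj L) (2 + 2) _ g : GL (Fin (2 + 2)) (AdeleRing (𝓞 L) L)) :
            Matrix (Fin (2 + 2)) (Fin (2 + 2)) (AdeleRing (𝓞 L) L)) *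
          ((SA⁻¹ : GL (Fin (2 + 2)) (AdeleRing (𝓞 L) L)) : Matrix (Fin (2 + 2)) (Fin (2 + 2)) (AdeleRing (𝓞 L) L)))
    (Y : AddSubgroup (AdeleRing (𝓞 L) L)) (hY : ∀ y, y ∈ Y ↔ conjAdele (Fp L) L (IsCMField.complexConj L) y = -y) :
    Continuous fun p : AdeleRing (𝓞 L) L × (Y × AdeleRing (𝓞 L) L) =>
      (⟨Ψ (jAdelic L 4 (nKlingen (AdeleRing (𝓞 L) L) (conjAdele (Fp L) L (IsCMField.complexConj L)) (conjAdele_conjAdele' L)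
          (p.2.1 : AdeleRing (𝓞 L) L) ((hY _).1 p.2.1.2) p.1 p.2.2)), transport_nKlingen_mem Ψ _ _ _ _⟩ : ↥(klingenUnipA Ψ)) :=
  Continuous.subtype_mk (continuous_transport_nKlingen hΨ _ (continuous_subtype_val.comp (continuous_fst.comp continuous_snd)) continuous_fst
    (continuous_snd.comp continuous_snd)) _

/-- the chart is injective (★ F4-0 `nKlingen_injective`). [cite: Xiong2013, §7 Lemma 7.1] -/
theorem klingenChart_injective (Ψ : (quasiSplit (Fp L) L (IsCMField.complexConj L) (2 + 2)).Adelic ≃ₜ* HA L e dV hdV dW hdW)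
    (Y : AddSubgroup (AdeleRing (𝓞 L) L)) (hY : ∀ y, y ∈ Y ↔ conjAdele (Fp L) L (IsCMField.complexConj L) y = -y) :
    Function.Injective fun p : AdeleRing (𝓞 L) L × (Y × AdeleRing (𝓞 L) L) =>
      (⟨Ψ (jAdelic L 4 (nKlingen (AdeleRing (𝓞 L) L) (conjAdele (Fp L) L (IsCMField.complexConj L)) (conjAdele_conjAdele' L)
          (p.2.1 : AdeleRing (𝓞 L) L) ((hY _).1 p.2.1.2) p.1 p.2.2)), transport_nKlingen_mem Ψ _ _ _ _⟩ : ↥(klingenUnipA Ψ)) := by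
  intro p q hpq
  have h := (jAdelic L 4).injective (Ψ.injective (congrArg Subtype.val hpq))
  obtain ⟨hy, hz, ht⟩ := nKlingen_injective (conjAdele_conjAdele' L) h
  exact Prod.ext hz (Prod.ext (Subtype.ext hy) ht)

/-- the chart is surjective (★ F4-1 `mem_klingenUnipA_iff`). [cite: Xiong2013, §7 Lemma 7.1] -/
theorem klingenChart_surjective (Ψ : (quasiSplit (Fp L) L (IsCMField.complexConj L) (2 + 2)).Adelic ≃ₜ* HA L e dV hdV dW hdW)
    (Y : AddSubgroup (AdeleRing (𝓞 L) L)) (hY : ∀ y, y ∈ Y ↔ conjAdele (Fp L) L (IsCMField.complexConj L) y = -y) :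
    Function.Surjective fun p : AdeleRing (𝓞 L) L × (Y × AdeleRing (𝓞 L) L) =>
      (⟨Ψ (jAdelic L 4 (nKlingen (AdeleRing (𝓞 L) L) (conjAdele (Fp L) L (IsCMField.complexConj L)) (conjAdele_conjAdele' L)
          (p.2.1 : AdeleRing (𝓞 L) L) ((hY _).1 p.2.1.2) p.1 p.2.2)), transport_nKlingen_mem Ψ _ _ _ _⟩ : ↥(klingenUnipA Ψ)) := by
  rintro ⟨u, hu⟩
  obtain ⟨y, hy, z, t, rfl⟩ := (mem_klingenUnipA_iff Ψ u).1 hu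
  exact ⟨(z, (⟨y, (hY y).2 hy⟩, t)), rfl⟩

/-- **THE HEISENBERG LAW IN THE CHART**: `Φ(z; y, t) · Φ(z′; y′, t′) = Φ(z + z′; y + y′ + (z′σt − tσz′), t + t′)` (★ F4-0 `nKlingen_mul`).
[cite: MoeglinWaldspurger1995, I.2.1] [cite: Xiong2013, §7 Lemma 7.1] -/
theorem klingenChart_mul (Ψ : (quasiSplit (Fp L) L (IsCMField.complexConj L) (2 + 2)).Adelic ≃ₜ* HA L e dV hdV dW hdW)
    (Y : AddSubgroup (AdeleRing (𝓞 L) L)) (hY : ∀ y, y ∈ Y ↔ conjAdele (Fp L) L (IsCMField.complexConj L) y = -y)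
    (z : AdeleRing (𝓞 L) L) (y : Y) (t : AdeleRing (𝓞 L) L) (z' : AdeleRing (𝓞 L) L) (y' : Y) (t' : AdeleRing (𝓞 L) L) :
    (⟨Ψ (jAdelic L 4 (nKlingen (AdeleRing (𝓞 L) L) (conjAdele (Fp L) L (IsCMField.complexConj L)) (conjAdele_conjAdele' L)
        (y : AdeleRing (𝓞 L) L) ((hY _).1 y.2) z t)), transport_nKlingen_mem Ψ _ _ _ _⟩ : ↥(klingenUnipA Ψ)) *
      ⟨Ψ (jAdelic L 4 (nKlingen (AdeleRing (𝓞 L) L) (conjAdele (Fp L) L (IsCMField.complexConj L)) (conjAdele_conjAdele' L)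
        (y' : AdeleRing (𝓞 L) L) ((hY _).1 y'.2) z' t')), transport_nKlingen_mem Ψ _ _ _ _⟩ =
      ⟨Ψ (jAdelic L 4 (nKlingen (AdeleRing (𝓞 L) L) (conjAdele (Fp L) L (IsCMField.complexConj L)) (conjAdele_conjAdele' L)
        (((⟨(y : AdeleRing (𝓞 L) L) + y' + (z' * conjAdele (Fp L) L (IsCMField.complexConj L) t - t * conjAdele (Fp L) L (IsCMField.complexConj L) z'),
            Y.add_mem (Y.add_mem y.2 y'.2) ((hY _).2 (skew_comm (conjAdele_conjAdele' L) z' t))⟩ : Y) : Y) : AdeleRing (𝓞 L) L)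
        ((hY _).1 (Y.add_mem (Y.add_mem y.2 y'.2) ((hY _).2 (skew_comm (conjAdele_conjAdele' L) z' t)))) (z + z') (t + t'))),
        transport_nKlingen_mem Ψ _ _ _ _⟩ := by
  refine Subtype.ext ?_
  change Ψ _ * Ψ _ = Ψ _
  rw [← map_mul, ← map_mul, nKlingen_mul]

/-- **the inverse coordinates are continuous**: `u ↦ (A₀₂; A₀₃ + A₀₂σ(A₀₁), A₀₁)` with `A` the matrix of `Ψ⁻¹u` — on `Ψ(n_Q(y,z,t))` this is `(z; y, t)`
(`klingenCoords_transport_nKlingen`). [cite: Weil1965, §37] [cite: Xiong2013, §7 Lemma 7.1] -/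
theorem continuous_klingenCoords (Ψ : (quasiSplit (Fp L) L (IsCMField.complexConj L) (2 + 2)).Adelic ≃ₜ* HA L e dV hdV dW hdW) :
    Continuous fun u : HA L e dV hdV dW hdW =>
      ((((adelicVal (Fp L) L (IsCMField.complexConj L) (2 + 2) _ (Ψ.symm u)) : GL (Fin (2 + 2)) (AdeleRing (𝓞 L) L)) :
          Matrix (Fin (2 + 2)) (Fin (2 + 2)) (AdeleRing (𝓞 L) L)) 0 2,
        ((((adelicVal (Fp L) L (IsCMField.complexConj L) (2 + 2) _ (Ψ.symm u)) : GL (Fin (2 + 2)) (AdeleRing (𝓞 L) L)) :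
              Matrix (Fin (2 + 2)) (Fin (2 + 2)) (AdeleRing (𝓞 L) L)) 0 3 +
            (((adelicVal (Fp L) L (IsCMField.complexConj L) (2 + 2) _ (Ψ.symm u)) : GL (Fin (2 + 2)) (AdeleRing (𝓞 L) L)) :
              Matrix (Fin (2 + 2)) (Fin (2 + 2)) (AdeleRing (𝓞 L) L)) 0 2 *
              conjAdele (Fp L) L (IsCMField.complexConj L)
                ((((adelicVal (Fp L) L (IsCMField.complexConj L) (2 + 2) _ (Ψ.symm u)) : GL (Fin (2 + 2)) (AdeleRing (𝓞 L) L)) :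
                  Matrix (Fin (2 + 2)) (Fin (2 + 2)) (AdeleRing (𝓞 L) L)) 0 1),
          (((adelicVal (Fp L) L (IsCMField.complexConj L) (2 + 2) _ (Ψ.symm u)) : GL (Fin (2 + 2)) (AdeleRing (𝓞 L) L)) :
            Matrix (Fin (2 + 2)) (Fin (2 + 2)) (AdeleRing (𝓞 L) L)) 0 1)) := by
  have hA : Continuous fun u : HA L e dV hdV dW hdW =>
      (((adelicVal (Fp L) L (IsCMField.complexConj L) (2 + 2) _ (Ψ.symm u)) : GL (Fin (2 + 2)) (AdeleRing (𝓞 L) L)) :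
        Matrix (Fin (2 + 2)) (Fin (2 + 2)) (AdeleRing (𝓞 L) L)) :=
    Units.continuous_val.comp (continuous_subtype_val.comp Ψ.symm.continuous)
  have hc := continuous_conjAdele (Fp L) L (IsCMField.complexConj L)
  exact (hA.matrix_elem 0 2).prodMk (((hA.matrix_elem 0 3).add ((hA.matrix_elem 0 2).mul (hc.comp (hA.matrix_elem 0 1)))).prodMk
    (hA.matrix_elem 0 1))

/-- **the coordinates of `Ψ(n_Q(y,z,t))` are `(z; y, t)`**. [cite: Xiong2013, §7 Lemma 7.1] -/
theorem klingenCoords_transport_nKlingen (Ψ : (quasiSplit (Fp L) L (IsCMField.complexConj L) (2 + 2)).Adelic ≃ₜ* HA L e dV hdV dW hdW)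
    (y : AdeleRing (𝓞 L) L) (hy : conjAdele (Fp L) L (IsCMField.complexConj L) y = -y) (z t : AdeleRing (𝓞 L) L) :
    ((((adelicVal (Fp L) L (IsCMField.complexConj L) (2 + 2) _
            (Ψ.symm (Ψ (jAdelic L 4 (nKlingen (AdeleRing (𝓞 L) L) (conjAdele (Fp L) L (IsCMField.complexConj L)) (conjAdele_conjAdele' L) y hy z t))))) :
            GL (Fin (2 + 2)) (AdeleRing (𝓞 L) L)) : Matrix (Fin (2 + 2)) (Fin (2 + 2)) (AdeleRing (𝓞 L) L)) 0 2,
        ((((adelicVal (Fp L) L (IsCMField.complexConj L) (2 + 2) _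
              (Ψ.symm (Ψ (jAdelic L 4 (nKlingen (AdeleRing (𝓞 L) L) (conjAdele (Fp L) L (IsCMField.complexConj L)) (conjAdele_conjAdele' L) y hy z t))))) :
              GL (Fin (2 + 2)) (AdeleRing (𝓞 L) L)) : Matrix (Fin (2 + 2)) (Fin (2 + 2)) (AdeleRing (𝓞 L) L)) 0 3 +
            (((adelicVal (Fp L) L (IsCMField.complexConj L) (2 + 2) _
              (Ψ.symm (Ψ (jAdelic L 4 (nKlingen (AdeleRing (𝓞 L) L) (conjAdele (Fp L) L (IsCMField.complexConj L)) (conjAdele_conjAdele' L) y hy z t))))) :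
              GL (Fin (2 + 2)) (AdeleRing (𝓞 L) L)) : Matrix (Fin (2 + 2)) (Fin (2 + 2)) (AdeleRing (𝓞 L) L)) 0 2 *
              conjAdele (Fp L) L (IsCMField.complexConj L)
                ((((adelicVal (Fp L) L (IsCMField.complexConj L) (2 + 2) _
                  (Ψ.symm (Ψ (jAdelic L 4 (nKlingen (AdeleRing (𝓞 L) L) (conjAdele (Fp L) L (IsCMField.complexConj L)) (conjAdele_conjAdele' L) y hy z t))))) :
                  GL (Fin (2 + 2)) (AdeleRing (𝓞 L) L)) : Matrix (Fin (2 + 2)) (Fin (2 + 2)) (AdeleRing (𝓞 L) L)) 0 1),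
          (((adelicVal (Fp L) L (IsCMField.complexConj L) (2 + 2) _
            (Ψ.symm (Ψ (jAdelic L 4 (nKlingen (AdeleRing (𝓞 L) L) (conjAdele (Fp L) L (IsCMField.complexConj L)) (conjAdele_conjAdele' L) y hy z t))))) :
            GL (Fin (2 + 2)) (AdeleRing (𝓞 L) L)) : Matrix (Fin (2 + 2)) (Fin (2 + 2)) (AdeleRing (𝓞 L) L)) 0 1)) = (z, (y, t)) := by
  rw [ContinuousMulEquiv.symm_apply_apply, coe_adelicVal_jAdelic, coe_nKlingen]
  simp [nKlingenM]

end Summit.HodgeConjecture.HodgeConjecture.Cruxes.HLiu418.K2LiuKlingenUnipotentAdelicChart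

end
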